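import Summits.PneNP.PneNP.Theorems.SoloBlindStreamingBoxes
import Summits.PneNP.PneNP.Theorems.SoloBlindSparseStreaming
import Literature.Computability.Complexity.LupanovBound
import Literature.Computability.Complexity.CircuitInputMap
import Literature.Computability.QuantumComplexity.ForrelationMemCorrect
import HarnessLib

/-!
# THEOREM H — the one-pass streaming space of `MCSP[s]` is `Θ(s log s)` (non-uniformly)

The McKay–Murray–Williams hypothesis `StreamingLowerBound s` of the tree (`UniformStreaming`)
asks, for EVERY `c`, that `MCSP[s] ∉ USTREAM (s(⌊log₂ N⌋)^c + c) (s(⌊log₂ N⌋)^c + c)`. This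
file pins down how much of that family is already decided by information theory, i.e. in the
tree's NON-UNIFORM one-pass model with no time bound used:

* **(H, lower bound)** `MCSPSize_streaming_space`: if a one-pass streaming algorithm decides
  `MCSP[s]` with states of length `≤ S N` on inputs of length `N` (`RunsInSpace`), `s n ≥ n`,
  then at every `n` with `2^36 ≤ s n ≤ 2^(n-10) / n`,
  `s n · ⌊log₂ s n⌋ ≤ 2^17 · (S (2^n) + 1)`.
  Hence level `c = 1` of the family holds for every algorithm whatsoever
  (`MCSPSize_not_mem_STREAM_level_one`, `MCSPSize_not_mem_USTREAM_level_one`) as soon as one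
  `n` has `2^(2^17+2) ≤ s n ≤ 2^(n-10)/n`.
* **(H′, upper bound)** `MCSPSize_mem_STREAM_slog`: for `s n ≥ n`,
  `MCSP[s] ∈ STREAM (2σ⌊log₂ σ⌋ + 11σ + 6) (5·(…) + 10)` with `σ = s(⌊log₂ N⌋)` — so every level
  `c ≥ 2` is false non-uniformly, and the information-theoretic threshold is `Θ(s log s)`.

Consequently the content of the MMW hypothesis that could imply `P ≠ NP` (their Theorem 1.3 needs
all `c`) lies entirely in the UNIFORMITY / update-TIME requirement at space between
`s log s / 2^17` and `2 s log s + O(s)`; below that band the lower bound is unconditional, above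
it the non-uniform upper bound rules out any information-theoretic argument.

Proof of (H) (`MCSPSize_boxes`, the parametric form
`2^r · 2^k ≤ mcspBits n (s n) + (S(2^n) + 1) · 2^r (2^r - 1)` for `1 ≤ k`, `k + r ≤ n`,
`36 · 2^k / k ≤ s n`). Diagonal YES-instances: the truth table on `n = m + r` variables of a
function `h` of the first `k` variables is the `2^r`-fold repetition of its truth table on `m`
variables (`truthTable_junta`, from `truthTable_snoc`), and it lies in `MCSP[s]` because a
`k`-junta has a `B2`-circuit of size `≤ 36 · 2^k / k ≤ s n` (Lupanov, `circuitSizeOver_junta_le`).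
There are `2^(2^k)` such `h` (`truthTable_junta_injective`) but at most `2^(mcspBits n (s n))`
YES-instances of length `2^n` (`MCSPSize_sparse`). The repetition bound
`card_pow_le_of_replicate_mem` of `SoloBlindStreamingBoxes` gives
`(2^(2^k))^(2^r) ≤ 2^mcspBits · (2^(S+1))^(2^r (2^r-1))`. The explicit form takes `r = 9` and the
scale `k` with `36 · 2^k ≤ k · s n ≤ 72 · 2^k` (`exists_scale`), where `mcspBits ≤ 165 · 2^k`
(`mcspBits_le_of_scale`) and `k + 10 ≤ n` (`scale_add_le`).

References: Lupanov's bound as in [Jukna2012, Thm. 1.15]; circuit counting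
[AroraBarak2009, Thm. 6.21]; the streaming model and hypothesis of [McKayMurrayWilliams2019,
§2, Thm. 1.3]. The calibration itself: [folklore]-level counting, not found in print for this
model (see the solo programme's paper, §4).
-/

namespace Summit.PneNP.PneNP.Theorems.SoloBlind

open Computability
open Literature.Computability.Complexity Literature.Computability.MetaComplexity
open Literature.Computability.MetaComplexity.McKayMurrayWilliams2019

/-! ### Juntas on the low variables -/

/-- Appending a last variable does not change the first `k ≤ n` coordinates. [folklore] -/
theorem snoc_castLE {k n : ℕ} (hk : k ≤ n) (hk' : k ≤ n + 1) (w : Fin n → Bool) (b : Bool)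
    (i : Fin k) : (Fin.snoc w b : Fin (n + 1) → Bool) (Fin.castLE hk' i) = w (Fin.castLE hk i) := by
  have : (Fin.castLE hk' i : Fin (n + 1)) = Fin.castSucc (Fin.castLE hk i) := Fin.ext rfl
  rw [this, Fin.snoc_castSucc]

/-- **Truth table of a low junta.** On `n ≥ m` variables, the truth table of a function of the
first `k ≤ m` variables is the `2^(n-m)`-fold repetition of its truth table on `m` variables
(the enumeration `boolFunEquivFin` has the last variable as the most significant bit,
`truthTable_snoc`). [folklore] -/
theorem truthTable_junta {k m : ℕ} (h : (Fin k → Bool) → Bool) (hk : k ≤ m) :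
    ∀ n, m ≤ n → ∀ hkn : k ≤ n,
      truthTable (fun z : Fin n → Bool => h fun i => z (Fin.castLE hkn i)) =
        (List.replicate (2 ^ (n - m))
          (truthTable fun z : Fin m → Bool => h fun i => z (Fin.castLE hk i))).flatten := by
  intro n hmn
  induction n, hmn using Nat.le_induction with
  | base => intro hkn; simp
  | succ n hmn ih =>
    intro hkn
    rw [Literature.Computability.QuantumComplexity.ForrMem.truthTable_snoc]
    simp only [snoc_castLE (hk.trans hmn) hkn]
    rw [ih (hk.trans hmn), ← List.flatten_append, ← List.replicate_add]
    congr 2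
    rw [show n + 1 - m = n - m + 1 by omega, pow_succ]
    ring

/-- The map `h ↦ tt(h as a function of the first k of m variables)` is injective (`k ≤ m`).
[folklore] -/
theorem truthTable_junta_injective {k m : ℕ} (hk : k ≤ m) :
    Function.Injective fun h : (Fin k → Bool) → Bool =>
      truthTable fun z : Fin m → Bool => h fun i => z (Fin.castLE hk i) := by
  intro h h' e
  dsimp only at e
  have e' := truthTable_injective e
  funext x
  have := congrFun e' fun j : Fin m => if hj : (j : ℕ) < k then x ⟨j, hj⟩ else false
  simpa using this

/-- **Small circuits for low juntas** (Lupanov): a function of the first `k ≥ 1` of `n` variables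
has a `B2`-circuit of size `≤ 36 · 2^k / k`. [cite: Jukna2012, Thm. 1.15] -/
theorem circuitSizeOver_junta_le {k n : ℕ} (hk : 1 ≤ k) (hkn : k ≤ n)
    (h : (Fin k → Bool) → Bool) :
    circuitSizeOver B2 (fun z : Fin n → Bool => h fun i => z (Fin.castLE hkn i)) ≤
      36 * 2 ^ k / k := by
  obtain ⟨C, hC, hs, hf⟩ := (cktSize_lupanov_div hk fun x (_ : Unit) => h x).toCircuit
  refine (circuitSizeOver_le_of_computes (C.mapInputs (Fin.castLE hkn)) (hC.mapInputs _)
    fun z => ?_).trans (by rw [Circuit.size_mapInputs]; exact hs)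
  rw [Circuit.eval_mapInputs, hf]

/-! ### THEOREM H, parametric form -/

/-- **THEOREM H (parametric).** If `A` decides `MCSP[s]` with states of length `≤ S N` on inputs
of length `N`, then for all `k ≥ 1`, `r` with `k + r ≤ n` and `36 · 2^k / k ≤ s n`:
`2^r · 2^k ≤ mcspBits n (s n) + (S (2^n) + 1) · 2^r · (2^r - 1)`. (The `2^(2^k)` truth tables of
`k`-juntas on `n - r` variables, repeated `2^r` times, are YES-instances; there are at most
`2^mcspBits` YES-instances; apply `card_pow_le_of_replicate_mem`.) No uniformity or time bound
is used. [folklore] -/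
theorem MCSPSize_boxes {A : StreamingAlgorithm} {S s : ℕ → ℕ} (hS : RunsInSpace A S)
    (hD : A.Decides (MCSPSize s)) {n k r : ℕ} (hk : 1 ≤ k) (hkn : k + r ≤ n)
    (hσ : 36 * 2 ^ k / k ≤ s n) :
    2 ^ r * 2 ^ k ≤ mcspBits n (s n) + (S (2 ^ n) + 1) * (2 ^ r * (2 ^ r - 1)) := by
  obtain ⟨m, rfl⟩ : ∃ m, n = m + r := ⟨n - r, by omega⟩
  have hkm : k ≤ m := by omega
  have hkn' : k ≤ m + r := by omega
  -- the YES-instances of length `2^(m+r)`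
  obtain ⟨Y, hYcard, hY⟩ := MCSPSize_sparse s (2 ^ (m + r))
  rw [Nat.log_pow Nat.one_lt_two] at hYcard
  -- the diagonal family: truth tables of the `k`-juntas on `m` variables
  have hlen : ∀ u ∈ (Finset.univ.image fun h : (Fin k → Bool) → Bool =>
      truthTable fun z : Fin m → Bool => h fun i => z (Fin.castLE hkm i)), u.length = 2 ^ m := by
    intro u hu
    obtain ⟨h, -, rfl⟩ := Finset.mem_image.1 hu
    exact length_truthTable _
  have hyes : ∀ u ∈ (Finset.univ.image fun h : (Fin k → Bool) → Bool =>
      truthTable fun z : Fin m → Bool => h fun i => z (Fin.castLE hkm i)),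
      (List.replicate (2 ^ r) u).flatten ∈ MCSPSize s := by
    intro u hu
    obtain ⟨h, -, rfl⟩ := Finset.mem_image.1 hu
    have e := truthTable_junta h hkm (m + r) (Nat.le_add_right m r) hkn'
    rw [Nat.add_sub_cancel_left] at e
    rw [← e, truthTable_mem_MCSPSize_iff]
    exact (circuitSizeOver_junta_le hk hkn' h).trans hσ
  have key := card_pow_le_of_replicate_mem hS hD (R := 2 ^ r) (ℓ := 2 ^ m) (N := 2 ^ (m + r))
    Nat.one_le_two_pow (by rw [pow_add, Nat.mul_comm]) _ Y hlen hyes hY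
  rw [Finset.card_image_of_injective _ (truthTable_junta_injective hkm)] at key
  simp only [Finset.card_univ, Fintype.card_fun, Fintype.card_bool, Fintype.card_fin] at key
  have key' : (2 ^ 2 ^ k) ^ 2 ^ r ≤
      2 ^ mcspBits (m + r) (s (m + r)) *
        (2 ^ (S (2 ^ (m + r)) + 1)) ^ (2 ^ r * (2 ^ r - 1)) :=
    key.trans (Nat.mul_le_mul_right _ hYcard)
  have key'' : 2 ^ (2 ^ k * 2 ^ r) ≤
      2 ^ (mcspBits (m + r) (s (m + r)) + (S (2 ^ (m + r)) + 1) * (2 ^ r * (2 ^ r - 1))) := by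
    rw [pow_add, pow_mul, pow_mul]; exact key'
  have hexp := (Nat.pow_le_pow_iff_right (by norm_num)).1 key''
  calc 2 ^ r * 2 ^ k = 2 ^ k * 2 ^ r := Nat.mul_comm _ _
    _ ≤ _ := hexp

/-! ### THEOREM H, explicit form -/

/-- Arithmetic: at a scale `k ≥ 36` with `k · σ ≤ 72 · 2^k` and `n ≤ σ`, the bit budget of the
easy functions is `mcspBits n σ ≤ 165 · 2^k`. [folklore] -/
theorem mcspBits_le_of_scale {n σ k : ℕ} (hn : n ≤ σ) (hk : 36 ≤ k) (hhi : k * σ ≤ 72 * 2 ^ k) :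
    mcspBits n σ ≤ 165 * 2 ^ k := by
  have h36 : 36 * σ ≤ k * σ := Nat.mul_le_mul_right σ hk
  have hσ : σ ≤ 2 * 2 ^ k := by omega
  have hsz : Nat.size (n + σ + 1) ≤ k + 3 := by
    have h8 : 2 ^ (k + 3) = 8 * 2 ^ k := by ring
    rw [Nat.size_le, h8]
    have := Nat.one_le_two_pow (n := k)
    omega
  have h2k : 2 * k + 6 ≤ 2 ^ k := by
    obtain ⟨j, rfl⟩ : ∃ j, k = j + 6 := ⟨k - 6, by omega⟩
    have hj : j < 2 ^ j := Nat.lt_two_pow_self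
    have h64 : 2 ^ (j + 6) = 64 * 2 ^ j := by ring
    rw [h64]
    omega
  unfold mcspBits
  calc (2 * σ + 2) * Nat.size (n + σ + 1) + 4 * σ ≤ (2 * σ + 2) * (k + 3) + 4 * σ := by gcongr
    _ = 2 * (k * σ) + 10 * σ + (2 * k + 6) := by ring
    _ ≤ 2 * (72 * 2 ^ k) + 10 * (2 * 2 ^ k) + 2 ^ k := by omega
    _ = 165 * 2 ^ k := by ring

/-- **THEOREM H (explicit, at a scale).** If `A` decides `MCSP[s]` (`s n ≥ n`) with states of
length `≤ S N`, then at every `n` and scale `k` with `36 ≤ k`, `k + 9 ≤ n`,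
`36 · 2^k ≤ k · s n ≤ 72 · 2^k`: `k · s n ≤ 2^16 · (S (2^n) + 1)`. [folklore] -/
theorem scale_mul_le_space {A : StreamingAlgorithm} {S s : ℕ → ℕ} (hS : RunsInSpace A S)
    (hD : A.Decides (MCSPSize s)) (hs : ∀ n, n ≤ s n) {n k : ℕ} (hk : 36 ≤ k) (hkn : k + 9 ≤ n)
    (hlo : 36 * 2 ^ k ≤ k * s n) (hhi : k * s n ≤ 72 * 2 ^ k) :
    k * s n ≤ 2 ^ 16 * (S (2 ^ n) + 1) := by
  have hσ : 36 * 2 ^ k / k ≤ s n := Nat.div_le_of_le_mul hlo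
  have h := MCSPSize_boxes hS hD (r := 9) (by omega) hkn hσ
  have hB := mcspBits_le_of_scale (hs n) hk hhi
  norm_num at h ⊢
  omega

/-- **Scales exist**: every `σ ≥ 2^36` has a scale `k ≥ 36` with `36 · 2^k ≤ k σ ≤ 72 · 2^k`
(take `k` maximal with `36 · 2^k ≤ k σ`). [folklore] -/
theorem exists_scale {σ : ℕ} (hσ : 2 ^ 36 ≤ σ) :
    ∃ k, 36 ≤ k ∧ 36 * 2 ^ k ≤ k * σ ∧ k * σ ≤ 72 * 2 ^ k := by
  classical
  have hex : ∃ j, (j + 1) * σ < 36 * 2 ^ (j + 1) := by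
    refine ⟨2 * σ + 1, ?_⟩
    have h1 : σ < 2 ^ σ := Nat.lt_two_pow_self
    have h2 : 2 ^ (2 * σ + 1 + 1) = 4 * (2 ^ σ * 2 ^ σ) := by ring
    rw [h2]
    nlinarith
  obtain ⟨k, hk, hmin⟩ : ∃ k, (k + 1) * σ < 36 * 2 ^ (k + 1) ∧
      ∀ j < k, ¬ ((j + 1) * σ < 36 * 2 ^ (j + 1)) :=
    ⟨Nat.find hex, Nat.find_spec hex, fun j hj => Nat.find_min hex hj⟩
  have hk36 : 36 ≤ k := by
    by_contra hlt
    push Not at hlt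
    have h1 : (k + 1) * 2 ^ 36 ≤ (k + 1) * σ := Nat.mul_le_mul_left _ hσ
    have h2 : (k + 1) * 2 ^ 36 < 36 * 2 ^ (k + 1) := h1.trans_lt hk
    interval_cases k <;> norm_num at h2
  refine ⟨k, hk36, ?_, ?_⟩
  · have h := hmin (k - 1) (by omega)
    rw [Nat.sub_add_cancel (by omega : 1 ≤ k), not_lt] at h
    exact h
  · have h1 : k * σ ≤ (k + 1) * σ := Nat.mul_le_mul_right σ (Nat.le_succ k)
    rw [pow_succ] at hk
    omega

/-- **Scales are small**: if `36 · 2^k ≤ k σ` with `2^36 ≤ σ ≤ 2^(n-10) / n` then `k + 10 ≤ n`.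
[folklore] -/
theorem scale_add_le {n σ k : ℕ} (hlo : 36 * 2 ^ k ≤ k * σ) (hσ : 2 ^ 36 ≤ σ)
    (hsmall : σ ≤ 2 ^ (n - 10) / n) : k + 10 ≤ n := by
  have hn : 1 ≤ n := by
    rcases Nat.eq_zero_or_pos n with rfl | hn
    · simp at hsmall; omega
    · exact hn
  have hσ' : σ * n ≤ 2 ^ (n - 10) := (Nat.le_div_iff_mul_le hn).1 hsmall
  have h46 : 46 ≤ n := by
    have h1 : 2 ^ 36 ≤ 2 ^ (n - 10) := hσ.trans (hsmall.trans (Nat.div_le_self _ _))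
    have h2 := (Nat.pow_le_pow_iff_right (by norm_num)).1 h1
    omega
  by_contra hcon
  push Not at hcon
  rcases Nat.lt_or_ge k n with hkn | hkn
  · -- `n - 9 ≤ k < n`: `36 · 2^k ≤ k σ ≤ n σ ≤ 2^(n-10) ≤ 2^k / 2`
    have h1 : k * σ ≤ n * σ := Nat.mul_le_mul_right σ hkn.le
    have h2 : 2 ^ (n - 10) ≤ 2 ^ k := Nat.pow_le_pow_right (by norm_num) (by omega)
    have h3 : n * σ = σ * n := Nat.mul_comm _ _
    have := Nat.one_le_two_pow (n := n - 10)
    omega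
  · -- `k ≥ n`: write `k = (n - 10) + j`
    obtain ⟨j, hj⟩ : ∃ j, k = n - 10 + j := ⟨k - (n - 10), by omega⟩
    have h1 : 36 * 2 ^ k * n ≤ k * (σ * n) := by
      rw [← Nat.mul_assoc]; exact Nat.mul_le_mul_right n hlo
    have h2 : k * (σ * n) ≤ k * 2 ^ (n - 10) := Nat.mul_le_mul_left k hσ'
    have h3 : (36 * (2 ^ j * n)) * 2 ^ (n - 10) ≤ k * 2 ^ (n - 10) := by
      have e : 36 * 2 ^ k * n = (36 * (2 ^ j * n)) * 2 ^ (n - 10) := by rw [hj, pow_add]; ring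
      rw [← e]; exact h1.trans h2
    have h4 : 36 * (2 ^ j * n) ≤ k := Nat.le_of_mul_le_mul_right h3 (Nat.two_pow_pos _)
    have h5 : j < 2 ^ j := Nat.lt_two_pow_self
    have h6 : (j + 1) * n ≤ 2 ^ j * n := Nat.mul_le_mul_right n h5
    have h7 : j + n ≤ (j + 1) * n := by nlinarith
    omega

/-- **THEOREM H (headline): the one-pass streaming space of `MCSP[s]` is `Ω(s log s)`.**
If `A` decides `MCSP[s]` (`s n ≥ n` for all `n`) with every state reached on an input of length
`N` of length `≤ S N`, then at every `n` with `2^36 ≤ s n ≤ 2^(n-10) / n`: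
`s n · ⌊log₂ (s n)⌋ ≤ 2^17 · (S (2^n) + 1)`. No uniformity or time bound is used. [folklore] -/
theorem MCSPSize_streaming_space {A : StreamingAlgorithm} {S s : ℕ → ℕ} (hS : RunsInSpace A S)
    (hD : A.Decides (MCSPSize s)) (hs : ∀ n, n ≤ s n) {n : ℕ} (hbig : 2 ^ 36 ≤ s n)
    (hsmall : s n ≤ 2 ^ (n - 10) / n) :
    s n * Nat.log 2 (s n) ≤ 2 ^ 17 * (S (2 ^ n) + 1) := by
  obtain ⟨k, hk, hlo, hhi⟩ := exists_scale hbig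
  have hkn : k + 10 ≤ n := scale_add_le hlo hbig hsmall
  have h := scale_mul_le_space hS hD hs hk (by omega) hlo hhi
  have hlog : Nat.log 2 (s n) ≤ k + 1 := by
    have h36 : 36 * s n ≤ k * s n := Nat.mul_le_mul_right _ hk
    have h4 : 2 ^ (k + 2) = 4 * 2 ^ k := by ring
    have hlt : s n < 2 ^ (k + 2) := by rw [h4]; omega
    exact Nat.le_of_lt_succ (Nat.log_lt_of_lt_pow (by omega) hlt)
  have hks : s n ≤ k * s n := Nat.le_mul_of_pos_left _ (by omega)
  calc s n * Nat.log 2 (s n) ≤ s n * (k + 1) := Nat.mul_le_mul_left _ hlog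
    _ = k * s n + s n := by ring
    _ ≤ 2 * (2 ^ 16 * (S (2 ^ n) + 1)) := by omega
    _ = 2 ^ 17 * (S (2 ^ n) + 1) := by ring

/-! ### Level one of the McKay–Murray–Williams family holds for every algorithm -/

/-- At space `S N = s(⌊log₂ N⌋) + 1` no algorithm at all decides `MCSP[s]`, provided some `n` has
`2^(2^17 + 2) ≤ s n ≤ 2^(n-10) / n` (and `s n ≥ n` throughout). [folklore] -/
theorem MCSPSize_level_one_false {A : StreamingAlgorithm} {s : ℕ → ℕ}
    (hS : RunsInSpace A fun N => s (Nat.log 2 N) + 1) (hD : A.Decides (MCSPSize s))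
    (hs : ∀ n, n ≤ s n) {n : ℕ} (hbig : 2 ^ (2 ^ 17 + 2) ≤ s n)
    (hsmall : s n ≤ 2 ^ (n - 10) / n) : False := by
  have h36 : 2 ^ 36 ≤ s n := (Nat.pow_le_pow_right (by norm_num) (by norm_num)).trans hbig
  have h := MCSPSize_streaming_space hS hD hs h36 hsmall
  simp only [Nat.log_pow Nat.one_lt_two] at h
  have hlog : 2 ^ 17 + 2 ≤ Nat.log 2 (s n) := Nat.le_log_of_pow_le (by norm_num) hbig
  have h1 : s n * (2 ^ 17 + 2) ≤ 2 ^ 17 * (s n + 1 + 1) := (Nat.mul_le_mul_left _ hlog).trans h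
  have hsn : s n ≤ 2 ^ 17 := by norm_num at h1; omega
  have h2 := (Nat.pow_le_pow_iff_right (by norm_num : 1 < 2)).1 (hbig.trans hsn)
  norm_num at h2

/-- **Level `c = 1` of `StreamingLowerBound s`, non-uniform version**: for every `T`,
`MCSP[s] ∉ STREAM (s(⌊log₂ N⌋) + 1) T`, provided `s n ≥ n` and some `n` has
`2^(2^17 + 2) ≤ s n ≤ 2^(n-10) / n`. [folklore] -/
theorem MCSPSize_not_mem_STREAM_level_one {s : ℕ → ℕ} (hs : ∀ n, n ≤ s n) {n : ℕ}
    (hbig : 2 ^ (2 ^ 17 + 2) ≤ s n) (hsmall : s n ≤ 2 ^ (n - 10) / n) (T : ℕ → ℕ) :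
    MCSPSize s ∉ STREAM (fun N => s (Nat.log 2 N) + 1) T := by
  rintro ⟨A, hA, -, hD⟩
  exact MCSPSize_level_one_false (runsInSpace_of_hasSpace hA) hD hs hbig hsmall

/-- **Level `c = 1` of `StreamingLowerBound s`** literally:
`MCSP[s] ∉ USTREAM (s(⌊log₂ N⌋)^1 + 1) (s(⌊log₂ N⌋)^1 + 1)`, provided `s n ≥ n` and some `n` has
`2^(2^17 + 2) ≤ s n ≤ 2^(n-10) / n`; the uniformity and the time bound are not used.
[folklore] -/
theorem MCSPSize_not_mem_USTREAM_level_one {s : ℕ → ℕ} (hs : ∀ n, n ≤ s n) {n : ℕ}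
    (hbig : 2 ^ (2 ^ 17 + 2) ≤ s n) (hsmall : s n ≤ 2 ^ (n - 10) / n) :
    MCSPSize s ∉ USTREAM (fun N => s (Nat.log 2 N) ^ 1 + 1) (fun N => s (Nat.log 2 N) ^ 1 + 1) := by
  rintro ⟨A, -, hA, -, -, hD⟩
  simp only [pow_one] at hA
  exact MCSPSize_level_one_false hA hD hs hbig hsmall

/-! ### THEOREM H′ — the matching non-uniform upper bound `O(s log s)` -/

/-- **THEOREM H′.** For `s n ≥ n`: `MCSP[s] ∈ STREAM (2σ⌊log₂ σ⌋ + 11σ + 6) (5(2σ⌊log₂ σ⌋ + 11σ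
+ 6) + 10)` with `σ = s(⌊log₂ N⌋)` — the sparse-language algorithm of `sparse_mem_STREAM` with the
circuit count `2^mcspBits`. Together with THEOREM H: the non-uniform one-pass streaming space of
`MCSP[s]` is `Θ(s log s)`, and every level `c ≥ 2` of `StreamingLowerBound s` fails
non-uniformly. [folklore] -/
theorem MCSPSize_mem_STREAM_slog (s : ℕ → ℕ) (hs : ∀ n, n ≤ s n) :
    MCSPSize s ∈ STREAM
      (fun N => 2 * s (Nat.log 2 N) * Nat.log 2 (s (Nat.log 2 N)) + 11 * s (Nat.log 2 N) + 6)
      (fun N => 5 * (2 * s (Nat.log 2 N) * Nat.log 2 (s (Nat.log 2 N)) +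
        11 * s (Nat.log 2 N) + 6) + 10) := by
  refine MCSPSize_mem_STREAM s (fun N => ?_) (fun N => le_rfl)
  set n := Nat.log 2 N
  set σ := s n
  set L := Nat.log 2 σ
  have hn : n ≤ σ := hs n
  have hN : Nat.size N ≤ n + 1 := Nat.size_le.2 (Nat.lt_pow_succ_log_self Nat.one_lt_two N)
  have hσL : σ < 2 ^ (L + 1) := Nat.lt_pow_succ_log_self Nat.one_lt_two σ
  have hsz : Nat.size (n + σ + 1) ≤ L + 2 := by
    have h4 : 2 ^ (L + 2) = 2 * 2 ^ (L + 1) := by ring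
    rw [Nat.size_le, h4]
    omega
  have hLσ : L ≤ σ := Nat.log_le_self 2 σ
  unfold mcspBits
  calc (2 * σ + 2) * Nat.size (n + σ + 1) + 4 * σ + Nat.size N + 1
      ≤ (2 * σ + 2) * (L + 2) + 4 * σ + (n + 1) + 1 := by gcongr
    _ ≤ 2 * σ * L + 11 * σ + 6 := by nlinarith [hn, hLσ]

end Summit.PneNP.PneNP.Theorems.SoloBlind
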